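import Literature.NumberTheory.Automorphic.ResGL2EigensystemCuspidalOrEisenstein
import Literature.NumberTheory.Automorphic.BianchiBoundaryBorel
import Literature.NumberTheory.Automorphic.BoundaryShapiroHecke
import HarnessLib

/-!
# Harder's dichotomy for `Res_{K/ℚ} GL₂`: a Hecke eigenclass is interior or lives on the Borel stratum

Topic `NumberTheory/Automorphic`; namespace `Literature.NumberTheory.Automorphic`, grouping
sub-namespace `ResGLnCohomology` (that of the receptacle
`ResGLnCohomology.levelCohomology k n K 𝔫 λ q = H^q(GL_n(K)⁺, Fun(GL_n(𝔸_K^∞)/K_f(𝔫), E_λ(k)))` of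
`ResGLnCohomology.lean`).  A *proofs* file (abbreviations with bodies and theorems; no named fact,
no instance, no `sorry`) under the named fact
`ResGLnCohomology.Harder1987_eigensystem_cuspidalOrEisenstein`
(`ResGL2EigensystemCuspidalOrEisenstein.lean`): **steps (A)–(B) of the printed proof of its
Eisenstein half** [Harder1987, §1 and §2.6 Thm. 1], for `GL₂` over ANY number field `K`, in the
vocabulary of the generic boundary layer `TwistedQuotient` (`CuspidalCohomologyGL`,
`BoundaryRestrictionHecke`, `BoundaryShapiro`, `BoundaryShapiroHecke`) exactly as
`BianchiBorelReduction` does it for the parallel-weight receptacle of an imaginary quadratic field —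
here for the group `GL₂(K)⁺` (totally positive determinant) and the coefficients
`E_λ = ⊗_{τ : K → k} V_{λ_τ}` of the `Res_{K/ℚ} GL₂` receptacle:

* `ResGLnCohomology.interiorLevelCohomology k n K 𝔫 λ q = H^q_!(S_{K_f(𝔫)}, Ẽ_λ)` — the interior
  part of the receptacle (any `n`): the classes trivialised on the equivariant cochains of the Tits
  building of `GL_n/K` (the poset `ParallelWeight.ProperSubspace K n` of proper non-zero subspaces of
  `Kⁿ`, on which `GL_n(K)⁺ ≤ GL_n(K)` acts monotonically), `TwistedQuotient.interiorCohomology`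
  [cite: Harder1987, §3.1 (p. 59), H_! = Ker(H → H(∂))] [cite: Schwermer2010, §5.3 and §12.2];
* `ResGLnCohomology.borelPos K = B(K)⁺`, the stabiliser of `∞ = [e₀] ∈ ℙ¹(K)` in `GL₂(K)⁺`
  (`mem_borelPos_iff`: upper triangular), and the TRANSITIVITY of `GL₂(K)⁺` on `ℙ¹(K)`
  (`exists_glTotPos_smul_lineZero_eq`: correct any `g` with `g • ∞ = W` by `diag(1, det g⁻¹) ∈ B(K)`
  to determinant `1`);
* `ResGLnCohomology.borelPosCohomology k K 𝔫 λ q = H^q(B(K)⁺, Fun(GL₂(𝔸_K^∞)/K_f(𝔫), E_λ(k)))`,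
  the cohomology of the Borel stratum, with its Hecke operators `borelPosHeckeOp`, `borelPosHeckeT`;
* `exists_borelEigenclass_of_not_mem_interiorLevelCohomology` — **a Hecke eigenclass of
  `H^q(S_{K_f(𝔫)}, Ẽ_λ)` which is NOT interior yields a NON-ZERO eigenclass of the Borel stratum
  with the same eigenvalues of `T_{w,1}, T_{w,2}` at almost all `w`** (restriction to the boundary
  is Hecke-equivariant and injective off `H_!`; the boundary cohomology is that of the single
  stratum of `∞`, by transitivity and Shapiro) [cite: Harder1987, §1];
* `Harder1987_eigensystem_cuspidalOrEisenstein_of_interior_of_borel` — the DICHOTOMY: the named fact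
  follows from (I) its restriction to interior classes `c ∈ H^q_!` (Harder's §3: `H_!` is cuspidal
  or residual [cite: Harder1987, §3.1 (3.1.1)–(3.1.4), §3.2 Prop. 3.2.4 and (3.2.5)]) and (II) the
  statement that every non-zero a.e.-eigenclass of the Borel stratum `H^q(B(F)⁺, Fun(GL₂(𝔸_F^∞)/
  K_f(𝔫), E_λ))` carries the eigensystem of a pair of algebraic Größencharaktere (Harder's Thm. 1:
  the boundary cohomology is induced from the algebraic Hecke characters of the torus
  [cite: Harder1987, §2.6 Thm. 1 (p. 56)]), both hypotheses spelled out (no new named fact).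

Nothing here is specific to totally real `K`; (I) and (II) are the two remaining halves of the
printed proof (see the NOTES of the fact's unit for the brick plan of (II): eigenvalue
factorisation on the stratum, `BorelEigenvalueFactorisation`, then the central and torus
eigensystems as Größencharaktere).

## References

* G. Harder, *Eisenstein cohomology of arithmetic groups. The case GL₂*, Invent. Math. 89 (1987)
  37–118, §1, §2.6 Thm. 1, §3.1–3.2. [Harder1987]
* J. Schwermer, *Geometric cycles, arithmetic groups and their cohomology*, Bull. AMS 47 (2010),
  §5.3, §6 (6.1)–(6.2), §12.2. [Schwermer2010]
-/

noncomputable section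

open scoped Classical
open NumberField IsDedekindDomain

namespace Literature.NumberTheory.Automorphic

namespace ResGLnCohomology

open ParallelWeight (ProperSubspace lineZero borel)

/-! ### The interior cohomology `H^q_!(S_{K_f(𝔫)}, Ẽ_λ)` of the receptacle -/

section Interior

variable (k : Type) [Field k] (n : ℕ) (K : Type) [Field K]

variable {k} in
/-- `GL_n(K)⁺` acts monotonically on the poset of proper non-zero subspaces of `Kⁿ` (through
`GL_n(K)`, `ParallelWeight.smul_properSubspace_mono`). [folklore] -/
theorem smul_properSubspace_mono_glTotPos (γ : glTotPos n K) :
    Monotone fun W : ProperSubspace K n => γ • W :=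
  ParallelWeight.smul_properSubspace_mono K n (γ : GL (Fin n) K)

variable [NumberField K]

/-- **`H^q_!(S_{K_f(𝔫)}, Ẽ_λ(k)) = Ker(H^q → H^q(∂S̄_{K_f(𝔫)}, Ẽ_λ))`**, the interior cohomology of
the `Res_{K/ℚ} GL_n` receptacle `levelCohomology k n K 𝔫 λ q`, with the Borel–Serre boundary
modelled on the Tits building of `GL_n/K` (the generic `TwistedQuotient.interiorCohomology` for
`Γ = GL_n(K)⁺` and the poset `ParallelWeight.ProperSubspace K n`).
[cite: Harder1987, §3.1 (p. 59)] [cite: Schwermer2010, §5.3 and §12.2] -/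
abbrev interiorLevelCohomology (𝔫 : Ideal (𝓞 K)) (lam : (K →+* k) → Fin n → ℤ) (q : ℕ) :
    Submodule k (levelCohomology k n K 𝔫 lam q) :=
  TwistedQuotient.interiorCohomology (V := CoeffModule k n K lam) (diagPos n K) (level n K 𝔫)
    (coeffRepPos k n K lam) (ProperSubspace K n) (smul_properSubspace_mono_glTotPos n K) q

end Interior

/-! ### `B(K)⁺` and the transitivity of `GL₂(K)⁺` on `ℙ¹(K)` -/

section Borel

variable (K : Type) [Field K]

/-- **`B(K)⁺ ≤ GL₂(K)⁺`**, the stabiliser of `∞ = [e₀] ∈ ℙ¹(K)` in `GL₂(K)⁺`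
(`TwistedQuotient.vertexStabilizer`, the subgroup along which `BoundaryShapiro` restricts): the
upper-triangular matrices of totally positive determinant (`mem_borelPos_iff`).
[cite: Harder1987, §1] -/
abbrev borelPos : Subgroup (glTotPos 2 K) :=
  TwistedQuotient.vertexStabilizer (Γ := glTotPos 2 K) (lineZero K)

variable {K} in
/-- `γ ∈ B(K)⁺ ↔ γ₁₀ = 0` (for `γ ∈ GL₂(K)⁺`). [cite: Harder1987, §1] -/
theorem mem_borelPos_iff (γ : glTotPos 2 K) :
    γ ∈ borelPos K ↔ ((γ : GL (Fin 2) K) : Matrix (Fin 2) (Fin 2) K) 1 0 = 0 := by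
  rw [← ParallelWeight.mem_stabilizer_lineZero_iff]
  change γ ∈ MulAction.stabilizer (glTotPos 2 K) (lineZero K) ↔ _
  rw [MulAction.mem_stabilizer_iff, MulAction.mem_stabilizer_iff, Subgroup.smul_def]

variable {K} in
/-- `γ ∈ B(K)⁺` iff its image in `GL₂(K)` lies in the Borel subgroup `B(K)`. [folklore] -/
theorem mem_borelPos_iff_coe_mem_borel (γ : glTotPos 2 K) :
    γ ∈ borelPos K ↔ (γ : GL (Fin 2) K) ∈ borel K := by
  rw [mem_borelPos_iff, ParallelWeight.mem_borel_iff]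

variable {K} in
/-- The correcting factor `diag(1, d⁻¹) ∈ GL₂(K)` (`d` a unit). [folklore] -/
def diagOneInv (d : Kˣ) : GL (Fin 2) K :=
  Matrix.GeneralLinearGroup.mkOfDetNeZero !![(1 : K), 0; 0, ((d⁻¹ : Kˣ) : K)] (by
    rw [Matrix.det_fin_two_of]
    simp)

variable {K} in
/-- `det diag(1, d⁻¹) = d⁻¹`. [folklore] -/
theorem det_diagOneInv (d : Kˣ) :
    ((Matrix.GeneralLinearGroup.det (diagOneInv d) : Kˣ) : K) = ((d⁻¹ : Kˣ) : K) := by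
  rw [Matrix.GeneralLinearGroup.val_det_apply, diagOneInv, Matrix.GeneralLinearGroup.val_mkOfDetNeZero,
    Matrix.det_fin_two_of]
  simp

variable {K} in
/-- `diag(1, d⁻¹)` is upper triangular, i.e. lies in `B(K)`. [folklore] -/
theorem diagOneInv_mem_borel (d : Kˣ) : diagOneInv d ∈ borel K := by
  rw [ParallelWeight.mem_borel_iff, diagOneInv, Matrix.GeneralLinearGroup.val_mkOfDetNeZero]
  simp

variable {K} in
/-- `g · diag(1, det g⁻¹)` has determinant `1`, hence lies in `GL₂(K)⁺`. [folklore] -/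
theorem mul_diagOneInv_det_mem_glTotPos (g : GL (Fin 2) K) :
    g * diagOneInv (Matrix.GeneralLinearGroup.det g) ∈ glTotPos 2 K := by
  rw [mem_glTotPos_iff]
  intro τ
  rw [map_mul, Units.val_mul, det_diagOneInv, Units.mul_inv, map_one]
  exact one_pos

/-- **`GL₂(K)⁺` acts transitively on `ℙ¹(K)`**: every vertex of the Tits building of `GL₂/K` is a
translate of `∞` by an element of totally positive (indeed trivial) determinant — take any
`g ∈ GL₂(K)` with `g • ∞ = W` (`ParallelWeight.exists_smul_lineZero_eq`) and correct it by
`diag(1, det g⁻¹) ∈ B(K) = Stab(∞)`. [cite: Harder1987, §1] [cite: Schwermer2010, §6 (6.1)] -/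
theorem exists_glTotPos_smul_lineZero_eq (W : ProperSubspace K 2) :
    ∃ γ : glTotPos 2 K, γ • lineZero K = W := by
  obtain ⟨g, hg⟩ := ParallelWeight.exists_smul_lineZero_eq K W
  refine ⟨⟨g * diagOneInv (Matrix.GeneralLinearGroup.det g), mul_diagOneInv_det_mem_glTotPos g⟩, ?_⟩
  have hb : diagOneInv (Matrix.GeneralLinearGroup.det g) • lineZero K = lineZero K :=
    MulAction.mem_stabilizer_iff.1 (diagOneInv_mem_borel (Matrix.GeneralLinearGroup.det g))
  rw [Subgroup.mk_smul, mul_smul, hb, hg]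

end Borel

/-! ### The cohomology of the Borel stratum and the reduction -/

section Cohomology

variable (k : Type) [Field k] (K : Type) [Field K] [NumberField K]

/-- **`H^q(B(K)⁺, Fun(GL₂(𝔸_K^∞)/K_f(𝔫), E_λ(k)))`**, the cohomology of the Borel stratum of the
Borel–Serre boundary of `S_{K_f(𝔫)}` (`TwistedQuotient.cohomology` for `Γ = B(K)⁺`, the diagonal
embedding and `E_λ` restricted to `B(K)⁺`). [cite: Harder1987, §1] -/
abbrev borelPosCohomology (𝔫 : Ideal (𝓞 K)) (lam : (K →+* k) → Fin 2 → ℤ) (q : ℕ) : ModuleCat k :=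
  TwistedQuotient.cohomology (V := CoeffModule k 2 K lam) ((diagPos 2 K).comp (borelPos K).subtype)
    (level 2 K 𝔫) ((coeffRepPos k 2 K lam).comp (borelPos K).subtype) q

/-- The Hecke operator `T_g = [K_f(𝔫) g K_f(𝔫)]`, `g ∈ GL₂(𝔸_K^∞)`, on the cohomology of the
Borel stratum. [cite: Harder1987, §1] -/
abbrev borelPosHeckeOp (𝔫 : Ideal (𝓞 K)) (lam : (K →+* k) → Fin 2 → ℤ) (q : ℕ)
    (g : BigHeckeGLn.FiniteAdelicGL 2 K) : Module.End k (borelPosCohomology k K 𝔫 lam q) :=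
  TwistedQuotient.heckeEnd (V := CoeffModule k 2 K lam) ((diagPos 2 K).comp (borelPos K).subtype)
    (level 2 K 𝔫) ((coeffRepPos k 2 K lam).comp (borelPos K).subtype) g q

/-- `T_{w,i} = [K_f(𝔫) t_{w,i} K_f(𝔫)]` on the cohomology of the Borel stratum (same elements
`BigHeckeGLn.heckeElement 2 K w i` as `ResGLnCohomology.heckeT`). [cite: Harder1987, §1] -/
abbrev borelPosHeckeT (𝔫 : Ideal (𝓞 K)) (lam : (K →+* k) → Fin 2 → ℤ) (q : ℕ)
    (w : HeightOneSpectrum (𝓞 K)) (i : ℕ) : Module.End k (borelPosCohomology k K 𝔫 lam q) :=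
  borelPosHeckeOp k K 𝔫 lam q (BigHeckeGLn.heckeElement 2 K w i)

variable {k K}

/-- **A non-interior eigenclass gives an eigenclass of the Borel stratum** (steps (A)–(B) of the
printed proof of the Eisenstein half): if `c ∈ H^q(S_{K_f(𝔫)}, Ẽ_λ(k))` is not in `H^q_!` and
`T_{w,1} c = a_{w,1} c`, `T_{w,2} c = a_{w,2} c` for almost all `w`, then there is a NON-ZERO
`y ∈ H^q(B(K)⁺, Fun(GL₂(𝔸_K^∞)/K_f(𝔫), E_λ(k)))` with `T_{w,1} y = a_{w,1} y`, `T_{w,2} y = a_{w,2} y`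
for almost all `w` (the restriction to the boundary is Hecke-equivariant and injective off `H_!`,
`ℙ¹(K)` is an antichain with one `GL₂(K)⁺`-orbit, Shapiro). [cite: Harder1987, §1] -/
theorem exists_borelEigenclass_of_not_mem_interiorLevelCohomology {𝔫 : Ideal (𝓞 K)}
    {lam : (K →+* k) → Fin 2 → ℤ} (q : ℕ) {c : levelCohomology k 2 K 𝔫 lam q}
    (hc : c ∉ interiorLevelCohomology k 2 K 𝔫 lam q) (a : HeightOneSpectrum (𝓞 K) → ℕ → k)
    (ha : ∀ᶠ w in Filter.cofinite,
      heckeT k 2 K 𝔫 lam q w 1 c = a w 1 • c ∧ heckeT k 2 K 𝔫 lam q w 2 c = a w 2 • c) :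
    ∃ y : borelPosCohomology k K 𝔫 lam q, y ≠ 0 ∧
      ∀ᶠ w in Filter.cofinite,
        borelPosHeckeT k K 𝔫 lam q w 1 y = a w 1 • y ∧ borelPosHeckeT k K 𝔫 lam q w 2 y = a w 2 • y := by
  -- index the two operators by `Bool`: `false ↦ T_{w,1}`, `true ↦ T_{w,2}`
  let jdx : Bool → ℕ := fun b => cond b 2 1
  have ha' : ∀ᶠ w in Filter.cofinite, ∀ b : Bool,
      heckeT k 2 K 𝔫 lam q w (jdx b) c = a w (jdx b) • c :=
    ha.mono fun w hw b => by cases b <;> simp only [jdx, cond_true, cond_false, hw.1, hw.2]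
  obtain ⟨y, hy0, hy⟩ :=
    TwistedQuotient.exists_stratum_eigenclass_of_not_isInterior (V := CoeffModule k 2 K lam)
      (diagPos 2 K) (level 2 K 𝔫) (coeffRepPos k 2 K lam) (ProperSubspace K 2)
      (smul_properSubspace_mono_glTotPos 2 K) (lineZero K)
      (ParallelWeight.properSubspace_two_eq_of_le K) (exists_glTotPos_smul_lineZero_eq K) q hc
      Filter.cofinite
      (fun (b : Bool) (w : HeightOneSpectrum (𝓞 K)) => BigHeckeGLn.heckeElement 2 K w (jdx b))
      (fun w b => a w (jdx b)) ha'
  exact ⟨y, hy0, hy.mono fun w hw => ⟨hw false, hw true⟩⟩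

end Cohomology

/-! ### The dichotomy: reduction of the named fact to its interior and Borel-stratum halves -/

open Literature.NumberTheory.GaloisRepresentations in
/-- **Harder's dichotomy for `Res_{F/ℚ} GL₂`.**  The named fact
`Harder1987_eigensystem_cuspidalOrEisenstein` follows from its two halves, spelled out as
hypotheses (no new named fact is introduced):
(I) the statement restricted to INTERIOR classes `c ∈ H^q_!(S_{K_f(𝔫)}, Ẽ_λ)` — Harder's Ch. III:
`H^•_! = H^•_cusp ⊕ H^•_{!,res}`, cuspidal classes carry the eigensystem of a cuspidal cohomological
`π`, residual ones that of `φ ∘ det` [cite: Harder1987, §3.1 (3.1.1)–(3.1.4), §3.2 Prop. 3.2.4 and (3.2.5)];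
(II) every non-zero a.e.-eigenclass of `T_{w,1}, T_{w,2}` in the cohomology
`H^q(B(F)⁺, Fun(GL₂(𝔸_F^∞)/K_f(𝔫), E_λ))` of the Borel stratum carries the eigensystem
`(ψ₁ + ψ₂, ψ₁ ψ₂ / N)` of a pair of algebraic Größencharaktere — Harder's Thm. 1, the boundary
cohomology is induced from the algebraic Hecke characters of the split torus
[cite: Harder1987, §2.6 Thm. 1 (p. 56)].  A class is interior or not; in the second case
`exists_borelEigenclass_of_not_mem_interiorLevelCohomology` moves its eigensystem to the stratum.
[cite: Harder1987, §1, §2.6 Thm. 1, §3.1–3.2, §4.2 Thm. 2] -/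
theorem Harder1987_eigensystem_cuspidalOrEisenstein_of_interior_of_borel
    (hI : ∀ (F : Type) [Field F] [NumberField F], NumberField.IsTotallyReal F →
      ∀ (hcpt : isCompact_glFiniteIntegralLevel 2 F) (E : Type) [Field E] (ι : E ≃+* ℂ)
        (𝔫 : Ideal (𝓞 F)), 𝔫 ≠ 0 →
      ∀ (lam : (F →+* E) → Fin 2 → ℤ) (q : ℕ) (c : levelCohomology E 2 F 𝔫 lam q),
        c ∈ interiorLevelCohomology E 2 F 𝔫 lam q → c ≠ 0 →
      ∀ (a : HeightOneSpectrum (𝓞 F) → ℕ → E),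
        (∀ᶠ w in Filter.cofinite, heckeT E 2 F 𝔫 lam q w 1 c = a w 1 • c ∧
          heckeT E 2 F 𝔫 lam q w 2 c = a w 2 • c) →
        (∃ π₀ : CuspidalAutomorphicRepData 2 F hcpt, π₀.1.IsRegularAlgebraic ∧
          ∀ᶠ w in Filter.cofinite, ∃ α : Multiset ℂ, π₀.1.HasSatakeParamAt w α ∧
            ι (a w 1) = ((Real.sqrt (w.residueCard : ℝ) : ℝ) : ℂ) * α.esymm 1 ∧
              ι (a w 2) = α.esymm 2) ∨
        (∃ (𝔣 : Ideal (𝓞 F)) (p₁ q₁ p₂ q₂ : InfinitePlace F → ℤ)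
            (ψ₁ ψ₂ : HeightOneSpectrum (𝓞 F) → ℂ),
          𝔣 ≠ ⊥ ∧ IsGrossencharakter 𝔣 p₁ q₁ ψ₁ ∧ IsGrossencharakter 𝔣 p₂ q₂ ψ₂ ∧
          ∀ᶠ w in Filter.cofinite, ι (a w 1) = ψ₁ w + ψ₂ w ∧
            ((Ideal.absNorm w.asIdeal : ℕ) : ℂ) * ι (a w 2) = ψ₁ w * ψ₂ w))
    (hB : ∀ (F : Type) [Field F] [NumberField F], NumberField.IsTotallyReal F →
      ∀ (E : Type) [Field E] (ι : E ≃+* ℂ) (𝔫 : Ideal (𝓞 F)), 𝔫 ≠ 0 →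
      ∀ (lam : (F →+* E) → Fin 2 → ℤ) (q : ℕ) (y : borelPosCohomology E F 𝔫 lam q), y ≠ 0 →
      ∀ (a : HeightOneSpectrum (𝓞 F) → ℕ → E),
        (∀ᶠ w in Filter.cofinite, borelPosHeckeT E F 𝔫 lam q w 1 y = a w 1 • y ∧
          borelPosHeckeT E F 𝔫 lam q w 2 y = a w 2 • y) →
        ∃ (𝔣 : Ideal (𝓞 F)) (p₁ q₁ p₂ q₂ : InfinitePlace F → ℤ)
            (ψ₁ ψ₂ : HeightOneSpectrum (𝓞 F) → ℂ),
          𝔣 ≠ ⊥ ∧ IsGrossencharakter 𝔣 p₁ q₁ ψ₁ ∧ IsGrossencharakter 𝔣 p₂ q₂ ψ₂ ∧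
          ∀ᶠ w in Filter.cofinite, ι (a w 1) = ψ₁ w + ψ₂ w ∧
            ((Ideal.absNorm w.asIdeal : ℕ) : ℂ) * ι (a w 2) = ψ₁ w * ψ₂ w) :
    Harder1987_eigensystem_cuspidalOrEisenstein := by
  intro F _ _ hF hcpt E _ ι 𝔫 h𝔫 lam q c hc a ha
  by_cases hci : c ∈ interiorLevelCohomology E 2 F 𝔫 lam q
  · exact hI F hF hcpt E ι 𝔫 h𝔫 lam q c hci hc a ha
  · obtain ⟨y, hy0, hy⟩ := exists_borelEigenclass_of_not_mem_interiorLevelCohomology q hci a ha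
    exact Or.inr (hB F hF E ι 𝔫 h𝔫 lam q y hy0 a hy)

end ResGLnCohomology

end Literature.NumberTheory.Automorphic

end
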